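import Mathlib
import Summits.Ventures.HodgeRepro.PeriodCloserC7Lift

/-!
# Tier4/LitRallis — the Rallis inner product formula and its local zeta integrals, AS PRINTED (GQT14)

Blind re-derivation cell `pub-hodge-repro`, Tier 4 (README §9–§10), seat `t4-lit-6` (gen 0), family = the
Rallis-inner-product / doubling / local-zeta-integral cluster (STATUS S11852).  Target tree path
`lean/Summits/Ventures/HodgeRepro/Tier4/LitRallis.lean`.  Every `def … : Prop` below is a PRINTED statement typed
with its hypotheses explicit over the night-2 interface of `PeriodCloserC7Lift.lean` (`C7Face`, `LiftInterface`);
NO published theorem is proved here (seat rule); the two theorems at the end are one-line compositions of the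
named Props.  Statement-exact quotes with page/line: HOME/proofs/t4/inputs/t4-lit-6.md rows I-t4-lit-6-1 … -7.

Source.  [GQT14] W. T. Gan, Y. Qiu, S. Takeda, *The regularized Siegel–Weil formula (the second term identity)
and the Rallis inner product formula*, Invent. Math. 198 (2014) 739–831 — read on the arXiv text
`paper:arxiv-1207.4709` (AUTHOR COPY; the Inventiones print is not held — README §8(iv)).  Notation there
(p0008:L40–L67): `V_r` an `ε`-hermitian space of dimension `m = m_0 + 2r` over `E`, `H_r = H(V_r)`, `ε_0 = 0` when
`E ≠ F`, `d(n) = n + ε_0`; `G(U_n)` the group lifted from; `s_{m,n} = (m − n − ε_0)/2`.  The route's instance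
(TIER3.md §1 item 3; `PeriodCloserC7Lift.lean`): hermitian `ε_0 = 0`, `n = dim W = 2`, `m = dim V = 3`
(`d(2) = 2 < 3 ≤ 4`), `r = 0` (`V` anisotropic), `s_{3,2} = ½`, `m = d(n) + 1`.

* Theorem 33 (§11.7, p0034:L117–L155) = the intro's Theorem 2 (p0006:L22–L51) with the twist `χ_V`:
  «Suppose that `d(n) < m ≤ 2·d(n)` and `r ≤ n`.  Let `π` be an irreducible cuspidal representation of `G(U_n)` and
  consider its global theta lift `Θ_{n,r}(π)` on `H(V_r)`.  Assume that `Θ_{n,j}(π) = 0` for `j < r`, so that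
  `Θ_{n,r}(π)` is cuspidal.  (i) For `φ_1, φ_2 ∈ ω_{ψ,χ_V,V_r,U_n}` and `f_1, f_2 ∈ π`, we have
  `⟨θ(φ_1, f_1), θ(φ_2, f_2)⟩ = [E:F] · Val_{s=s_{m,n}} L(s + ½, π × χ_V) · Z^*(s, φ_1 ⊗ φ̄_2, f_1, f_2)`, where
  `s_{m,n} = (m − n − ε_0)/2 > 0`, and `Z^*(s, −)` denotes the normalized doubling zeta integral as in ((E:Z^*)).
  (ii) Assume further that for all places `v` of `F`, the local theta lift `Θ_{n,r}(π_v)` is nonzero.  Then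
  `L(s + ½, π × χ_V)` is holomorphic at `s = s_{m,n}`, so that in the context of (i),
  `⟨θ(φ_1, f_1), θ(φ_2, f_2)⟩ = [E:F] · L(s_{m,n} + ½, π × χ_V) · Z^*(s_{m,n}, φ_1 ⊗ φ̄_2, f_1, f_2)`.  In particular,
  the global theta lift `Θ_{n,r}(π)` is nonzero if and only if (a) for all places `v`, `Z_v^*(s_{m,n})` is nonzero
  on `R(V_{r,v}) ⊗ π_v^∨ ⊗ π_v`, and (b) `L(s_{m,n} + ½, π × χ_V) ≠ 0`.»
* §11.6 (p0034:L60–L111): `Z_v(s, Φ_v, f_{1,v}, f_{2,v}) = ∫_{G(U_n)(F_v)} Φ_v(g_v, 1) · conj⟨π_v(g_v) f_1, f_2⟩ dg_v`;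
  «`Z^*_v(s, Φ_v, f_{1,v}, f_{2,v}) := Z_v(s, Φ_v, f_{1,v}, f_{2,v}) / L(s + ½, π_v × χ_{V,v})`.  Then `Z^*_v(s, …)`
  is an entire function of `s` and for any `s_0` such that `Re(s_0) ≥ 0`, one can find a standard section `Φ` and
  `f_{i,v} ∈ π_v` such that `Z^*_v(s_0, Φ_v, f_{1,v}, f_{2,v}) ≠ 0`.  Note that when every data involved is
  unramified (which is the case for almost all `v`), one has `Z_v(s, …) = L(s + ½, π_v × χ_{V,v}) / d_v(s, χ_v)`
  … so that `Z^*(s, Φ, f_1, f_2) := ∏_v Z^*_v(s, Φ_v, f_{1,v}, f_{2,v})` is absolutely convergent (and thus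
  holomorphic) when `Re(s) > 0`.»
* Conjecture 34 / Proposition 35 (§11.8, p0035:L40–L90): «Conjecture 34. The local theta lift `Θ_{n,r}(π_v)` is
  nonzero if and only if `Z_v^*(s_{m,n})` is nonzero on `R(V_{r,v}) ⊗ π_v^∨ ⊗ π_v` (where `0 < s_{m,n} ≤ d(n)/2`).
  Note that the implication (⟸) is obvious, so the content of the conjecture is the reverse implication.»
  «Proposition 35. Suppose that `0 < s_{m,n} ≤ d(n)/2`.  (i) Assume that one of the following conditions hold:
  • `v` is finite, or • `ε_0 = −1`, or • `ε_0 = 0`, `v` is archimedean and `E_v = F_v × F_v`, or • `ε_0 = 1` and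
  `F_v = ℂ`.  Then the local theta lift `Θ_{n,r}(π_v)` is nonzero if and only if `Z_v^*(s_{m,n})` is nonzero on
  `R(V_{r,v}) ⊗ π_v^∨ ⊗ π_v`.  (ii) Assume that we are in a case not covered by (i), i.e. • `ε_0 = 0`, `F_v = ℝ`
  and `E_v = ℂ`, or • `ε_0 = 1`, `F_v = ℝ`.  Suppose that the signature of `V_{r,v}` is `(p,q)` with `p + q = m`.
  If the local theta lift `Θ_{n,r}(π_v)` is nonzero, then there is an `ε`-Hermitian space `V_v'` over `E_v` such
  that (a) the signature `(p',q')` of `V_v'` (with `p' + q' = m`) satisfies `p ≡ p' mod 4` if `ε_0 = 1`,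
  `p ≡ p' mod 2` if `ε_0 = 0`.  (b) `Z_v^*(s_{m,n})` is nonzero on `R(V_v') ⊗ π_v^∨ ⊗ π_v`; When `m = d(n) + 1`,
  one has `V_v' = V_{r,v}`.»

WHAT IS BUILT INTO THE TYPINGS (README §9: every hypothesis listed).  The route's instance is fixed (`n = 2`,
`m = 3`, `r = 0`, `ε_0 = 0`, so `d(n) < m ≤ 2d(n)`, `m = d(n) + 1`, `s_{m,n} = ½`, and the vanishing hypothesis
`Θ_{n,j}(π) = 0` for `j < r = 0` is empty); `π = τ : I.Tau` ranges over the `U(W)`-representations of the face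
interface (GQT14's «irreducible cuspidal» is the standing meaning of `I.Tau` — on the definite `U(W)` every
irreducible automorphic representation is cuspidal); the edge value `L(s_{3,2} + ½, τ × χ_V) = L(1, τ × χ_V)` is
`J.edgeLValue τ` (as in `PeriodCloserC7Lift.lean`); the normalized local zeta integrals are taken AT the point
`s = s_{m,n} = ½` only (`ZetaInterface.localZetaStar`), so §11.6's `s_0` is instantiated at `s_0 = ½ ≥ 0`;
«`Z_v^*(s_{m,n})` is nonzero on `R(V_{r,v}) ⊗ π_v^∨ ⊗ π_v`» is rendered as «some local datum IN THE IMAGE OF THE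
WEIL REPRESENTATION (`inWeilImage`) has `Z_v^* ≠ 0`», while §11.6's existence sentence ranges over ALL standard
sections (no `inWeilImage`); the Euler product `Z^* = ∏_v Z_v^*` is rendered with the finite set `badPlaces` of
places outside which the normalized factor is `1` (the unramified computation, p0034:L95–L111, holds AS A FIELD of
the interface, `unramified_one`); the finite / archimedean dichotomy of Prop 35 is the field `IsFinite` (at a real
place of the totally real field the CM extension is `E_v = ℂ`, `F_v = ℝ` — Prop 35 (ii)'s first bullet — and
Prop 35 (i)'s third bullet never occurs on a CM face).  Theorem 33 (i)'s `Val_{s=s_{m,n}}` (a limit in `s`) is not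
typed: only (ii), the case every line consumes, is.  Nothing here says anything about the status of the Hodge
conjecture for CM abelian varieties, which is NOT proved.
-/

set_option autoImplicit false

noncomputable section

namespace Summit.Ventures.HodgeRepro.Tier4.Lit

open NumberField
open Summit.Ventures.HodgeRepro.PeriodCloser

variable {L : Type} [Field L] [NumberField L] [IsCMField L]

/-- **The doubling zeta-integral interface** on top of the lift interface `J : LiftInterface I` of
`PeriodCloserC7Lift.lean`: the local data of GQT14 §11.6 (a section `Φ_v` of the degenerate principal series
`I_n(s_{m,n}, χ_{V,v})` and two vectors `f_{1,v}, f_{2,v} ∈ τ_v`), the normalized local zeta integral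
`Z_v^*(s_{m,n}, Φ_v, f_{1,v}, f_{2,v})` at the route's point `s_{m,n} = ½`, the global pure-tensor data with their
finite set of bad places, the Petersson pairing `⟨θ(φ_1, f_1), θ(φ_2, f_2)⟩` of two theta lifts, and the degree
`[E:F]`.  The fields are the OBJECTS the printed statements talk about; the statements themselves are the
`def … : Prop` below. -/
structure ZetaInterface (I : C7Face L) (J : LiftInterface I) where
  /-- `v` is a finite place (Prop 35 (i), first bullet); otherwise `v` is real with `E_v = ℂ` (Prop 35 (ii)) -/
  IsFinite : I.Place → Prop
  /-- the local data at `v` for `τ`: a standard section `Φ_v` and vectors `f_{1,v}, f_{2,v} ∈ τ_v` (§11.6) -/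
  LocalData : I.Place → I.Tau → Type
  /-- the section lies in `R(V_{r,v})`, the image of the Weil representation (`Φ_v = Φ^{n,0}(φ_v)`) -/
  inWeilImage : ∀ (v : I.Place) (τ : I.Tau), LocalData v τ → Prop
  /-- `Z_v^*(s_{m,n}, Φ_v, f_{1,v}, f_{2,v})` — the normalized local doubling zeta integral at `s = s_{m,n} = ½`
  ((E:Z^*), p0034:L83–L87) -/
  localZetaStar : ∀ (v : I.Place) (τ : I.Tau), LocalData v τ → ℂ
  /-- global pure-tensor data `(Φ = ⊗_v Φ_v, f_1 = ⊗_v f_{1,v}, f_2 = ⊗_v f_{2,v})` with `Φ = Φ^{n,0}(φ_1 ⊗ φ̄_2)` -/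
  GlobalData : I.Tau → Type
  /-- the local component at `v` of a global datum -/
  localOf : ∀ (τ : I.Tau), GlobalData τ → ∀ v : I.Place, LocalData v τ
  /-- the finite set of places where some datum is ramified -/
  badPlaces : ∀ (τ : I.Tau), GlobalData τ → Finset I.Place
  /-- the unramified computation (p0034:L95–L111): outside `badPlaces` the normalized local factor is `1`
  (`Z_v = L(s + ½, π_v × χ_{V,v}) / d_v(s, χ_v)` with `d_v(s_{m,n}, χ_V)` absorbed into the normalisation of the
  global product, as GQT14 do for `Re(s) > 0`) -/
  unramified_one : ∀ (τ : I.Tau) (D : GlobalData τ) (v : I.Place), v ∉ badPlaces τ D →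
    localZetaStar v τ (localOf τ D v) = 1
  /-- the Petersson inner product `⟨θ(φ_1, f_1), θ(φ_2, f_2)⟩` of the two theta lifts of the datum -/
  pairing : ∀ (τ : I.Tau), GlobalData τ → ℂ
  /-- `[E:F]` -/
  degree : ℕ

/-- **[GQT14] Theorem 33 (ii) — the Rallis inner product formula when every local lift is non-zero**
(p0034:L138–L148): «Assume further that for all places `v` of `F`, the local theta lift `Θ_{n,r}(π_v)` is nonzero.
Then … `⟨θ(φ_1, f_1), θ(φ_2, f_2)⟩ = [E:F] · L(s_{m,n} + ½, π × χ_V) · Z^*(s_{m,n}, φ_1 ⊗ φ̄_2, f_1, f_2)`», with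
`Z^* = ∏_v Z_v^*` (p0034:L107) rendered through the finite set of bad places (`unramified_one`).  Route instance
`n = 2`, `m = 3`, `r = 0`, `s_{m,n} = ½`, `L(1, τ × χ_V) = J.edgeLValue τ`. -/
def GQT14_Thm33_ii (I : C7Face L) (J : LiftInterface I) (Z : ZetaInterface I J) : Prop :=
  ∀ τ : I.Tau, (∀ v : I.Place, J.localLiftNonzero v τ) →
    ∀ D : Z.GlobalData τ,
      Z.pairing τ D = (Z.degree : ℂ) * J.edgeLValue τ *
        ∏ v ∈ Z.badPlaces τ D, Z.localZetaStar v τ (Z.localOf τ D v)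

/-- **[GQT14] Theorem 33 (ii), the criterion** (p0034:L150–L155, inside (ii)'s standing hypothesis that every local
lift is non-zero): «In particular, the global theta lift `Θ_{n,r}(π)` is nonzero if and only if (a) for all places
`v`, `Z_v^*(s_{m,n})` is nonzero on `R(V_{r,v}) ⊗ π_v^∨ ⊗ π_v`, and (b) `L(s_{m,n} + ½, π × χ_V) ≠ 0`.»  The
global lift `Θ_{n,r}(τ) ≠ 0` is `J.thetaNonzero τ`. -/
def GQT14_Thm33_criterion (I : C7Face L) (J : LiftInterface I) (Z : ZetaInterface I J) : Prop :=
  ∀ τ : I.Tau, (∀ v : I.Place, J.localLiftNonzero v τ) →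
    (J.thetaNonzero τ ↔
      ((∀ v : I.Place, ∃ x : Z.LocalData v τ, Z.inWeilImage v τ x ∧ Z.localZetaStar v τ x ≠ 0) ∧
        J.edgeLValue τ ≠ 0))

/-- **[GQT14] §11.6, the local non-vanishing for SOME standard section** (p0034:L88–L93): «for any `s_0` such that
`Re(s_0) ≥ 0`, one can find a standard section `Φ` and `f_{i,v} ∈ π_v` such that
`Z^*_v(s_0, Φ_v, f_{1,v}, f_{2,v}) ≠ 0`» — at `s_0 = s_{m,n} = ½`.  The section is NOT required to lie in
`R(V_{r,v})` and the vectors are FREE (this is not the fixed-`K`-type statement of the route's (E5)). -/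
def GQT14_Sec11_6_exists_nonzero (I : C7Face L) (J : LiftInterface I) (Z : ZetaInterface I J) : Prop :=
  ∀ (v : I.Place) (τ : I.Tau), ∃ x : Z.LocalData v τ, Z.localZetaStar v τ x ≠ 0

/-- **[GQT14] Conjecture 34, the «obvious» implication** (p0035:L45–L46): «Note that the implication (⟸) is
obvious» — a non-zero `Z_v^*(s_{m,n})` on `R(V_{r,v}) ⊗ π_v^∨ ⊗ π_v` forces the local theta lift to be non-zero. -/
def GQT14_Conj34_easy (I : C7Face L) (J : LiftInterface I) (Z : ZetaInterface I J) : Prop :=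
  ∀ (v : I.Place) (τ : I.Tau),
    (∃ x : Z.LocalData v τ, Z.inWeilImage v τ x ∧ Z.localZetaStar v τ x ≠ 0) → J.localLiftNonzero v τ

/-- **[GQT14] Proposition 35 (i) at the finite places** (p0035:L52–L67, first bullet): «Then the local theta lift
`Θ_{n,r}(π_v)` is nonzero if and only if `Z_v^*(s_{m,n})` is nonzero on `R(V_{r,v}) ⊗ π_v^∨ ⊗ π_v`.»  Hypothesis
`0 < s_{m,n} ≤ d(n)/2` holds on the route instance (`½ ≤ 1`). -/
def GQT14_Prop35_i_finite (I : C7Face L) (J : LiftInterface I) (Z : ZetaInterface I J) : Prop :=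
  ∀ (v : I.Place), Z.IsFinite v → ∀ τ : I.Tau,
    (J.localLiftNonzero v τ ↔ ∃ x : Z.LocalData v τ, Z.inWeilImage v τ x ∧ Z.localZetaStar v τ x ≠ 0)

/-- **[GQT14] Proposition 35 (ii) at the real places, with `m = d(n) + 1`** (p0035:L69–L90): for `ε_0 = 0`,
`F_v = ℝ`, `E_v = ℂ`: «If the local theta lift `Θ_{n,r}(π_v)` is nonzero, then there is an `ε`-Hermitian space
`V_v'` over `E_v` such that … (b) `Z_v^*(s_{m,n})` is nonzero on `R(V_v') ⊗ π_v^∨ ⊗ π_v`; When `m = d(n) + 1`, one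
has `V_v' = V_{r,v}`.»  On the route instance `m = 3 = d(2) + 1`, so `V_v' = V_{r,v}` and the conclusion is the
non-vanishing on `R(V_{r,v})` itself. -/
def GQT14_Prop35_ii_real (I : C7Face L) (J : LiftInterface I) (Z : ZetaInterface I J) : Prop :=
  ∀ (v : I.Place), ¬ Z.IsFinite v → ∀ τ : I.Tau,
    J.localLiftNonzero v τ → ∃ x : Z.LocalData v τ, Z.inWeilImage v τ x ∧ Z.localZetaStar v τ x ≠ 0

/-- Composition (no published content): at EVERY place of the route instance a non-zero local lift gives a datum
in `R(V_{r,v})` with `Z_v^* ≠ 0` — Prop 35 (i) at the finite places, Prop 35 (ii) with `m = d(n) + 1` at the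
real places. -/
theorem exists_weil_zeta_ne_zero_of_localLift (I : C7Face L) (J : LiftInterface I) (Z : ZetaInterface I J)
    (h35i : GQT14_Prop35_i_finite I J Z) (h35ii : GQT14_Prop35_ii_real I J Z) (v : I.Place) (τ : I.Tau)
    (hv : J.localLiftNonzero v τ) :
    ∃ x : Z.LocalData v τ, Z.inWeilImage v τ x ∧ Z.localZetaStar v τ x ≠ 0 := by
  by_cases hf : Z.IsFinite v
  · exact (h35i v hf τ).mp hv
  · exact h35ii v hf τ hv

/-- Composition (no published content): under Theorem 33 (ii)'s standing hypothesis (every local lift non-zero),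
Theorem 33's criterion together with Prop 35 reduces the non-vanishing of the global lift to the edge `L`-value
alone — the «(ii) converse» half that `PeriodCloserC7Lift.E5_of_lift` consumes from `GQT14_Thm3`. -/
theorem thetaNonzero_iff_edgeLValue_of_localLifts (I : C7Face L) (J : LiftInterface I) (Z : ZetaInterface I J)
    (hcrit : GQT14_Thm33_criterion I J Z) (h35i : GQT14_Prop35_i_finite I J Z)
    (h35ii : GQT14_Prop35_ii_real I J Z) (τ : I.Tau) (hloc : ∀ v : I.Place, J.localLiftNonzero v τ) :
    J.thetaNonzero τ ↔ J.edgeLValue τ ≠ 0 := by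
  rw [hcrit τ hloc]
  constructor
  · exact fun h => h.2
  · exact fun h => ⟨fun v => exists_weil_zeta_ne_zero_of_localLift I J Z h35i h35ii v τ (hloc v), h⟩

end Summit.Ventures.HodgeRepro.Tier4.Lit

end
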